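import Summits.CriticalPhenomena.PercolationContinuityZ3.Theses.PercThresholdOne
import Summits.CriticalPhenomena.PercolationContinuityZ3.Theorems.PercThresholdOneFKGImpliesMonotoneFactor
import Summits.CriticalPhenomena.PercolationContinuityZ3.Theorems.PercThresholdOneMonotoneFactorImpliesLocalRule

/-!
# `FKGImpliesLocalRule` (route PercThresholdOne, item stmt-CriticalPhenomena-14218)

Glue of the threshold-one ladder, BY NAME: crux #3 `NoFragileGiantFKG` (no stationary, positively
associated law on nearest-neighbour bond configurations of `ℤ³` with a unique dense weaving giant is
exponentially fragile under every independent thinning) implies the target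
`NoFragileGiantLocalRule` (the same for configurations `F(U)` of a FINITE-RANGE measurable antitone
lattice-equivariant factor `F` of i.i.d. uniform edge labels `U`).

Proof: compose the two landed rungs — `fkgImpliesMonotoneFactor_proof : FKGImpliesMonotoneFactor`
(crux #3 ⇒ crux #2: push-forward `ν = (labelMeasure).map F`, invariance from equivariance and the
invariance of i.i.d. labels under injective relabelling, positive association from Harris'
inequality for the product measure applied to the decreasing preimages `F ⁻¹' A`; item
stmt-CriticalPhenomena-5261) and `monotoneFactorImpliesLocalRule_proof : MonotoneFactorImpliesLocalRule`
(crux #2 ⇒ target by forgetting the range hypothesis; item stmt-CriticalPhenomena-14217). The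
antecedent and consequent of `FKGImpliesMonotoneFactor` are by definition the bodies of
`NoFragileGiantFKG` and `NoFragileGiantMonotoneFactor`, so the composition elaborates by unfolding.
-/

namespace Summit.CriticalPhenomena.PercolationContinuityZ3.Theorems

open Summit.CriticalPhenomena.PercolationContinuityZ3.Theses.PercThresholdOne

/-- **Support item stmt-CriticalPhenomena-14218.** `NoFragileGiantFKG → NoFragileGiantLocalRule`:
the correlation-inequality rung implies the finite-range target, through the monotone-factor rung
(`fkgImpliesMonotoneFactor_proof`) and the specialisation to finite range
(`monotoneFactorImpliesLocalRule_proof`). -/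
theorem fkgImpliesLocalRule_proof : FKGImpliesLocalRule := by
  unfold FKGImpliesLocalRule
  intro h3
  have h2 : NoFragileGiantMonotoneFactor := fkgImpliesMonotoneFactor_proof h3
  exact monotoneFactorImpliesLocalRule_proof h2

end Summit.CriticalPhenomena.PercolationContinuityZ3.Theorems
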